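import Mathlib.MeasureTheory.Integral.Bochner.Basic
import Mathlib.MeasureTheory.Measure.Typeclasses.Probability
import Mathlib.Analysis.SpecialFunctions.Exp
import Mathlib.Analysis.SpecialFunctions.Sqrt
import Literature.ComputerArithmetic.ConnollyHighamMary2021.StochasticRounding
import HarnessLib

/-!
# Stochastic rounding: probabilistic error bounds under mean independence (named facts)

HONEST FRAMING: certified error envelopes and provably optimal rounding/accumulation schemes for
low-precision formats under stated cost models; every table by two implementations; no hardware or
vendor claims.

Sources.
* M. P. Connolly, N. J. Higham, T. Mary, *Stochastic rounding and its probabilistic backward error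
  analysis*, SIAM J. Sci. Comput. 43(1) (2021) A566–A585 [cite: ConnollyHighamMary2021]: Lemma 4.5
  (rounding errors of mode-2 SR are mean independent with mean zero), Theorem 4.6 (probabilistic bound
  for products `∏ (1+δᵢ)^{ρᵢ}` of mean-independent bounded errors, via the Azuma–Hoeffding inequality),
  Lemma 4.12 (`E ∏(1+δₖ) = 1`), Theorem 4.13 (recursive summation / inner products / matrix–vector
  products / triangular solves under SR have expectation equal to the exact result).
* E.-M. El Arar, D. Sohier, P. de Oliveira Castro, E. Petit, *Stochastic rounding variance and
  probabilistic bounds: a new approach*, SIAM J. Sci. Comput. 45(5) (2023) C255–C275, arXiv:2207.10321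
  [cite: ArarEtAl2023]: Definition 2.1 (mean independence), Lemma 2.3 (= CHM21 Lemma 4.5), Lemma 3.1
  (`E ψ_K = 1`, `V(ψ_K) ≤ γₙ(u²) = (1+u²)ⁿ − 1`).
* N. J. Higham, T. Mary, *A new approach to probabilistic rounding error analysis*, SIAM J. Sci.
  Comput. 41(5) (2019) A2815–A2835 [cite: HighamMary2019]: Theorem 2.4 (the same product bound for
  INDEPENDENT errors; the constant `γ̃ₙ(λ)` below is its (2.6)).

Design. The published statements are measure-theoretic ("random variables δₖ with |δₖ| ≤ u,
mean independent, E δₖ = 0"). We type the STOCHASTIC ROUNDING ERROR MODEL as a structure of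
hypotheses `SRErrorModel μ u δ` over an arbitrary probability space, with mean independence in its
defining (test-function) form `E[g(δ₀,…,δₖ₋₁)·δₖ] = 0` for bounded measurable `g` — equivalent to
`E[δₖ | δ₀,…,δₖ₋₁] = 0` for bounded `δₖ` and free of conditional-expectation versions. The results we
have not proved here are NAMED FACTS (`def … : Prop`, D-0014), to be used as hypotheses `(h : Fact)`.
The algebraic content of CHM21 Lemma 4.4 / Thm 4.13 for FINITE formats (incl. saturation and
subnormals) is proved exactly, without measure theory, in the companion venture files
(`Venture.CertifiedArithmetic.LowPrec.SR`: `accExp_id_of_noSat`, `accExp_sq_sub`).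

Transcription caveat (for the reviewer): the display formulas of CHM21 §4 did not survive text
extraction of the held PDF; `gammaTilde` and the probability `1 − 2·exp(−λ²/2)` of `productBoundCHM`
are transcribed from CHM21 Thm 4.6 as restated from HighamMary2019 (2.6)/Thm 2.4 (there with
probability `1 − 2exp(−λ²(1−u)²/2)` under independence). El Arar et al. Lemma 3.1 is verbatim from
arXiv:2207.10321 pp. 5–6.

NOT here: CHM21 Thm 4.9/4.11 (inner products, matrix–vector, triangular solves with the constants
`Q(λ,n)`), El Arar Thm 3.2/3.5 (inner-product and Horner variance bounds with condition numbers) —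
to be typed when the primary displays are confirmed.
-/

namespace Literature.ComputerArithmetic.ConnollyHighamMary2021

open _root_.MeasureTheory
open Finset

/-- **The stochastic-rounding error model** (CHM21 Lemma 4.5 / El Arar et al. Def. 2.1, Lemma 2.3):
a sequence of real random variables `δ₀, δ₁, …` on a probability space, each measurable and bounded
by the unit roundoff `u`, and MEAN INDEPENDENT WITH MEAN ZERO: for every `k` and every bounded
measurable test function `g` of the past errors, `E[g(δ₀,…,δₖ₋₁) δₖ] = 0` (for `k = 0`: `E δ₀ = 0`).
[cite: ConnollyHighamMary2021, Lemma 4.5] -/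
structure SRErrorModel {Ω : Type*} [MeasurableSpace Ω] (μ : Measure Ω) (u : ℝ) (δ : ℕ → Ω → ℝ) :
    Prop where
  measurable : ∀ k, Measurable (δ k)
  bounded : ∀ k ω, |δ k ω| ≤ u
  meanIndep : ∀ (k : ℕ) (g : (Fin k → ℝ) → ℝ), Measurable g → (∃ C, ∀ v, |g v| ≤ C) →
    ∫ ω, g (fun i => δ i ω) * δ k ω ∂μ = 0

/-- The relaxed constant `γ̃ₙ(λ) = exp(λ √n u + n u²/(1 − u)) − 1 = λ√n·u + O(u²)`.
[cite: ConnollyHighamMary2021, Thm. 4.6] -/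
noncomputable def gammaTilde (n : ℕ) (u lam : ℝ) : ℝ :=
  Real.exp (lam * Real.sqrt n * u + n * u ^ 2 / (1 - u)) - 1

/-- El Arar et al.'s `γₙ(u²) = (1 + u²)ⁿ − 1 ≈ n u²`. [cite: ArarEtAl2023, Lemma 3.1] -/
def gammaSq (n : ℕ) (u : ℝ) : ℝ := (1 + u ^ 2) ^ n - 1

/-- **CHM21 Theorem 4.6 (probabilistic product bound under mean independence).** If the `δᵢ` follow
the SR error model with `0 < u < 1`, then for exponents `ρᵢ = ±1` and every `λ > 0`,
`|∏_{i<n} (1 + δᵢ)^{ρᵢ} − 1| ≤ γ̃ₙ(λ)` holds with probability at least `1 − 2 exp(−λ²/2)`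
(Azuma–Hoeffding). Named fact. [cite: ConnollyHighamMary2021, Thm. 4.6] -/
def productBoundCHM : Prop :=
  ∀ (Ω : Type) [MeasurableSpace Ω] (μ : Measure Ω) [IsProbabilityMeasure μ] (u : ℝ) (δ : ℕ → Ω → ℝ),
    0 < u → u < 1 → SRErrorModel μ u δ →
    ∀ (n : ℕ) (ρ : ℕ → ℤ), (∀ i, ρ i = 1 ∨ ρ i = -1) → ∀ lam : ℝ, 0 < lam →
      μ {ω | gammaTilde n u lam < |(∏ i ∈ range n, (1 + δ i ω) ^ (ρ i)) - 1|}
        ≤ ENNReal.ofReal (2 * Real.exp (-lam ^ 2 / 2))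

/-- **CHM21 Lemma 4.12 / El Arar et al. Lemma 3.1(1).** Under the SR error model, for every finite set
`K` of error indices, `E ∏_{k∈K} (1 + δₖ) = 1`. Named fact.
[cite: ConnollyHighamMary2021, Lemma 4.12] -/
def productMeanOne : Prop :=
  ∀ (Ω : Type) [MeasurableSpace Ω] (μ : Measure Ω) [IsProbabilityMeasure μ] (u : ℝ) (δ : ℕ → Ω → ℝ),
    SRErrorModel μ u δ → ∀ K : Finset ℕ, ∫ ω, ∏ k ∈ K, (1 + δ k ω) ∂μ = 1

/-- **El Arar et al. Lemma 3.1(3) (variance of an error product).** Under the SR error model,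
`V(∏_{k∈K}(1 + δₖ)) ≤ γ_{|K|}(u²) = (1 + u²)^{|K|} − 1`. Named fact. [cite: ArarEtAl2023, Lemma 3.1] -/
def productVarianceBound : Prop :=
  ∀ (Ω : Type) [MeasurableSpace Ω] (μ : Measure Ω) [IsProbabilityMeasure μ] (u : ℝ) (δ : ℕ → Ω → ℝ),
    SRErrorModel μ u δ → ∀ K : Finset ℕ,
      ∫ ω, ((∏ k ∈ K, (1 + δ k ω)) - 1) ^ 2 ∂μ ≤ gammaSq K.card u

/-- **CHM21 Theorem 4.13 (summation case): SR recursive summation is unbiased.** In the standard model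
the computed sum is `ŝ = ∑ᵢ xᵢ ∏_{k ∈ Kᵢ} (1 + δₖ)` where `Kᵢ` indexes the roundings that touch `xᵢ`;
under the SR error model `E ŝ = ∑ᵢ xᵢ` whatever the index sets (no underflow/overflow is implicit in
the model `|δₖ| ≤ u`). Named fact; an immediate consequence of `productMeanOne` and linearity.
[cite: ConnollyHighamMary2021, Thm. 4.13] -/
def recursiveSumUnbiased : Prop :=
  ∀ (Ω : Type) [MeasurableSpace Ω] (μ : Measure Ω) [IsProbabilityMeasure μ] (u : ℝ) (δ : ℕ → Ω → ℝ),
    SRErrorModel μ u δ → ∀ (n : ℕ) (x : ℕ → ℝ) (K : ℕ → Finset ℕ),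
      ∫ ω, ∑ i ∈ range n, x i * ∏ k ∈ K i, (1 + δ k ω) ∂μ = ∑ i ∈ range n, x i

/-- Sanity link (proved): the error model forces `E δₖ = 0` for every `k` (take `g ≡ 1`).
[cite: ConnollyHighamMary2021, Lemma 4.5] -/
theorem SRErrorModel.integral_eq_zero {Ω : Type*} [MeasurableSpace Ω] {μ : Measure Ω} {u : ℝ}
    {δ : ℕ → Ω → ℝ} (h : SRErrorModel μ u δ) (k : ℕ) : ∫ ω, δ k ω ∂μ = 0 := by
  have := h.meanIndep k (fun _ => 1) measurable_const ⟨1, fun _ => by simp⟩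
  simpa using this

end Literature.ComputerArithmetic.ConnollyHighamMary2021
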